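import Mathlib
import Summits.ValiantsHypothesis.ValiantsHypothesis.Theses.FeketeSOS

/-!
# `FeketeBoundedFanin` — negative lemma: `ReciprocalRigidity` (card `reciprocal-rigidity`, first rung) is false
(crux triage r1-2)

Crux `stmt-ValiantsHypothesis-3998` (`FeketeSOS.FeketeBoundedFanin`), idea card `reciprocal-rigidity`
(`Cruxes/FeketeBoundedFanin/Ideas/reciprocal-rigidity.md`, Sketch `SketchIdeator3.lean`, decl `Ideator3.ReciprocalRigidity`):
"if a product of two polynomials of degree `< p` over a field of characteristic `p` is a nonzero constant to order `N` at
`X = 1` without being that constant, then `|supp U| + |supp V| ≥ N^{1/2+δ}`".  FALSE as typed, by Frobenius: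
`U = X`, `V = X^{p−1}` give `U·V − 1 = X^p − 1 = (X − 1)^p`, so `U·V ≡ 1` to order `N = p − 1 ≤ p − 1` with two monomials.
Repairs needed before any use: cyclic non-triviality `¬ (X^p − 1 ∣ U·V − C κ)` AND `N ≤ p − 2` (the socle tiling
`X·(∑_{i<a}X^i)(∑_{j<b}X^{aj}) ≡ −1 (mod (X−1)^{p−1})`, `ab = p − 1`, has `a + b ≈ 2√p` monomials).  Statement inlined verbatim.
-/

set_option linter.dupNamespace false

open Polynomial

namespace Summit.ValiantsHypothesis.ValiantsHypothesis.Theorems.FeketeBoundedFanin.Negative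

/-- **`Ideator3.ReciprocalRigidity` (inlined verbatim) is false**: Frobenius witness `X · X^{p−1} = X^p ≡ 1 (mod (X−1)^p)`
over `ZMod p`, `p ≥ 7` prime, `N = p − 1`, support-sum `2 < (p−1)^{1/2+δ}`. [folklore] -/
theorem reciprocalRigidity_false :
    ¬ (∃ δ : ℝ, 0 < δ ∧ ∃ N₀ : ℕ, ∀ (k : Type) [Field k] (p : ℕ) [Fact p.Prime] [CharP k p]
        (U V : Polynomial k) (κ : k) (N : ℕ),
          κ ≠ 0 → N₀ ≤ N → N ≤ p - 1 → U.natDegree < p → V.natDegree < p →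
          ((X - 1) ^ N : Polynomial k) ∣ (U * V - Polynomial.C κ) → U * V ≠ Polynomial.C κ →
          (N : ℝ) ^ (1 / 2 + δ) ≤ (U.support.card : ℝ) + (V.support.card : ℝ)) := by
  rintro ⟨δ, hδ, N₀, H⟩
  obtain ⟨p, hp_ge, hp⟩ := Nat.exists_infinite_primes (max (N₀ + 1) 7)
  haveI : Fact p.Prime := ⟨hp⟩
  have hN₀ : N₀ ≤ p - 1 := by have := le_of_max_le_left hp_ge; omega
  have hp7 : 7 ≤ p := le_of_max_le_right hp_ge
  have hdegU : (X : (ZMod p)[X]).natDegree < p := by rw [natDegree_X]; omega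
  have hdegV : (X ^ (p - 1) : (ZMod p)[X]).natDegree < p := by rw [natDegree_X_pow]; omega
  have hprod : (X : (ZMod p)[X]) * X ^ (p - 1) = X ^ p := by
    rw [← pow_succ', Nat.sub_add_cancel hp.one_lt.le]
  have hfrob : (X : (ZMod p)[X]) * X ^ (p - 1) - C 1 = (X - 1) ^ p := by
    rw [hprod, map_one, sub_pow_char, one_pow]
  have hdvd : ((X - 1) ^ (p - 1) : (ZMod p)[X]) ∣ (X * X ^ (p - 1) - C 1) := by
    rw [hfrob]; exact pow_dvd_pow _ (Nat.sub_le p 1)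
  have hne : (X : (ZMod p)[X]) * X ^ (p - 1) ≠ C 1 := by
    intro h
    have h2 := congrArg natDegree h
    rw [hprod, natDegree_X_pow, map_one, natDegree_one] at h2
    exact hp.ne_zero h2
  have key := H (ZMod p) p X (X ^ (p - 1)) 1 (p - 1) one_ne_zero hN₀ le_rfl hdegU hdegV hdvd hne
  have h1 : ((X : (ZMod p)[X]).support.card : ℝ) = 1 := by rw [support_X]; simp
  have h2 : ((X ^ (p - 1) : (ZMod p)[X]).support.card : ℝ) = 1 := by rw [support_X_pow]; simp
  rw [h1, h2] at key
  have hp1 : (6 : ℝ) ≤ ((p - 1 : ℕ) : ℝ) := by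
    have : 6 ≤ p - 1 := by omega
    exact_mod_cast this
  have hge1 : (1 : ℝ) ≤ ((p - 1 : ℕ) : ℝ) := by linarith
  have hmono : ((p - 1 : ℕ) : ℝ) ^ ((1 : ℝ) / 2) ≤ ((p - 1 : ℕ) : ℝ) ^ ((1 : ℝ) / 2 + δ) :=
    Real.rpow_le_rpow_of_exponent_le hge1 (by linarith)
  have hsqrt : Real.sqrt 6 ≤ ((p - 1 : ℕ) : ℝ) ^ ((1 : ℝ) / 2) := by
    rw [Real.sqrt_eq_rpow]
    exact Real.rpow_le_rpow (by norm_num) hp1 (by norm_num)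
  have h6 : (2 : ℝ) < Real.sqrt 6 := by
    rw [show (2 : ℝ) = Real.sqrt 4 by
      rw [show (4 : ℝ) = 2 ^ 2 by norm_num, Real.sqrt_sq (by norm_num : (0:ℝ) ≤ 2)]]
    exact Real.sqrt_lt_sqrt (by norm_num) (by norm_num)
  linarith

end Summit.ValiantsHypothesis.ValiantsHypothesis.Theorems.FeketeBoundedFanin.Negative
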